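import Summits.HodgeConjecture.HodgeConjecture.Theorems.F0D6CmCurveBodyAShapes   -- ★ previous part of the same Lines workfile `D6CmCurveBodyA` (size-lint split ×5)
import HarnessLib

/-!
# `F0D6CmCurveBodyAJunction` — ★ RE-HOME of `Lines/D6CmCurveBodyA.lean`, PART 3 of 5 (size-lint split; cut at a top-level declaration boundary).

See PART 1 `Theorems/F0D6CmCurveBodyAGlue.lean` for the full re-home header and the original module docstring (verbatim there). Namespaces KEPT
(re-opened below exactly as they stand at the cut, with their `open` lines); code bytes = the workfile՚s, docstrings included; options preamble repeated from PART 1.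
HC_CM is proved only modulo the 7 printed citations (2 remaining: hLiu418 = stmt-HodgeConjecture-24832, h413 = stmt-HodgeConjecture-24833) until rung 0 closes; a re-home is count-neutral. -/

noncomputable section

open scoped TensorProduct NumberField
open NumberField IsDedekindDomain Filter
open Literature.NumberTheory.GaloisRepresentations
open Literature.NumberTheory.Automorphic
open Literature.NumberTheory.Automorphic.Liu2021.AppendixC
open scoped TensorProduct Matrix NumberField Kronecker ComplexOrder
open NumberField NumberField.InfinitePlace IsDedekindDomain
open Summit.HodgeConjecture.CorCM.Model Summit.HodgeConjecture.CorCM.Model.HComp Summit.HodgeConjecture.CorCM.HComp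
open Literature.AlgebraicGeometry.Motives (CMType)
open Literature.AlgebraicGeometry.ShimuraVarieties.UnitaryCanonicalModel
open Literature.NumberTheory.Automorphic Literature.NumberTheory.Automorphic.UnitaryGroup
open Literature.NumberTheory.Automorphic.IdeleClassGroup Literature.NumberTheory.Automorphic.Liu2021 Literature.NumberTheory.Automorphic.Liu2021.AppendixC
open Literature.NumberTheory.GaloisRepresentations Literature.RepresentationTheory.Liu2021 Literature.RepresentationTheory.HarrisKudlaSweet1996
open Literature.AlgebraicGeometry.Liu2021 (IsAdmissibleElement)
open Literature.NumberTheory.Weil1964 Literature.NumberTheory.GelbartRogawski1991 Literature.NumberTheory.GelbartRogawski1991.UnitaryDualPair Literature.NumberTheory.GelbartRogawski1991.UnitaryDualPair.WeilCoinv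
open Literature.NumberTheory.GelbartRogawski1991.UnitaryDualPair.LocalSplitting
open Literature.NumberTheory.Automorphic.Liu2021.Def411WeilCarriersDoubling
open Literature.NumberTheory.Automorphic.Liu2021.Def411WeilCarriers (TW JW JW_eq isSymm_TW isUnit_det_TW Rep Eps epsOf Chi rhoVAtLine)

namespace Summit.HodgeConjecture.CorCM.Lines.A3Liu418
open D6Glue
open CategoryTheory
open Literature.AlgebraicGeometry.Motives (AbelianVariety)

/-- **`S3ShapeM` — [Liu2021, Cor. D.9] in WORLD M: print's congruence relation for `M` transported to the tree tower `X = M ⊗_{F,c} F`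
(`sec42DataGS_X`, `rfl`; `towerRep` = honest Tate representation of `Alb(X_K)`): Frobenius at `𝔓 ∣ w` pairs with the spherical Hecke operators at
the CONJUGATE split place `c • w` (extra binder `hw'`; good reduction and hyperspeciality read at `c • w` ∕ `(c • w)⁺ = w⁺`), (R1)(R2)(R3), D2/D3 BY NAME.**  Given `ᵗ(cJ⋆) = J⋆` and `J⋆ ∈ GL₂(F)`: off a finite set `S₀`, at every `w` split over `w⁺` with `J⋆_w ∈ GL₂(𝒪_w)`,
for every level `K` hyperspecial at `w⁺`, every arithmetic Frobenius `σ` at `𝔓 ∣ w`, every `f′ ∈ Hom(ι′ ∘ ω⋆, ℚ̄_ℓ ⊗ H¹_ét)` and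
every `x ∈ ω⋆^K`: `q_w • Φ_σ(Φ_σ(f′(T_{w,2} x))) − Φ_σ(f′(T_{w,1} x)) + f′ x = 0`. -/
def S3ShapeM : Prop :=
  ∀ (F : CMField) [IsGalois ℚ F] (ι₁ : F →+* ℂ)
    (μ : Literature.NumberTheory.Automorphic.IdeleClassGroup (F : Type) →ₜ* Circle)
    (hμ : IdeleClassGroup.IsConjugateSymplectic (F : Type) μ)
    (_hw : IdeleClassGroup.HasWeight (F : Type) μ 1)
    (ℓ : ℕ) [Fact ℓ.Prime] (ι' : ℂ ≃+* AlgebraicClosure ℚ_[ℓ])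
    (Jstar : Matrix (Fin 2) (Fin 2) (F : Type)) (t : (F : Type)) (ht : t ≠ 0) (_hτt : 0 < (ι₁ t).re) (_hτt' : (ι₁ t).im = 0)
    (gstar : GL (Fin 2) (F : Type))
    (dJ : Fin 2 → (F : Type)) (hdJ : ∀ i, IsCMField.complexConj (F : Type) (dJ i) = dJ i) (hdJ0 : ∀ i, dJ i ≠ 0)
    (hg : formCongr ((IsCMField.complexConj (F : Type) : (F : Type) ≃ₐ[↥(maximalRealSubfield (F : Type))] (F : Type)) :
        (F : Type) →+* (F : Type)) gstar (t • Jstar) = Matrix.diagonal dJ)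
    (_hsig : (∃ Tstar : GL (Fin 2) ℂ,
        formCongr (starRingEnd ℂ) Tstar ((Matrix.diagonal dJ).map ι₁) = Matrix.diagonal ![(1 : ℂ), -1]) ∧
      ∀ τ' : (F : Type) →+* ℂ, InfinitePlace.mk τ' ≠ InfinitePlace.mk ι₁ → ((Matrix.diagonal dJ).map τ').PosDef)
    (K₀ : C5.OpenCompactSubgroup ↥(finAdelic ↥(maximalRealSubfield (F : Type)) (F : Type) (IsCMField.complexConj (F : Type)) 2 Jstar))
    (S : RecordSystemGS (F : Type) Jstar ι₁ K₀) (hU7ₛ : S.HeckeTranslateDefinedOver) (hLQ : S.IsLevelQuotient)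
    (h4 : 4 ≤ Module.finrank ℚ (F : Type)) (isoₛ : ℕ → Prop)
    (r : Rep ↥(maximalRealSubfield (F : Type)) (imagUnitSq F))
    (ε : Eps ↥(maximalRealSubfield (F : Type)) (imagUnitSq F))
    (_hadm : ∃ e : (F : Type), IsAdmissibleElement (F : Type) hμ.cmType.1 e ∧
      epsOf ↥(maximalRealSubfield (F : Type)) (imagUnitSq F) (F : Type) (2 * imagUnit (F : Type))⁻¹ (-e) = ε)
    (χ : Chi ↥(maximalRealSubfield (F : Type)) (F : Type) (IsCMField.complexConj (F : Type))),
    ∀ (hJ : (Jstar.map (IsCMField.complexConj (F : Type)))ᵀ = Jstar) (hJu : IsUnit Jstar) (K : C5.SmallLevel K₀),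
    ∃ S₀ : Set (HeightOneSpectrum (𝓞 (F : Type))), S₀.Finite ∧
      ∀ w : HeightOneSpectrum (𝓞 (F : Type)), w ∉ S₀ → ∀ hw : (IsCMField.complexConj (F : Type)) • w ≠ w,
        ∀ hw' : (IsCMField.complexConj (F : Type)) • ((IsCMField.complexConj (F : Type)) • w) ≠ ((IsCMField.complexConj (F : Type)) • w),
        (UnitaryGroup.isUnit_placeForm Jstar hJu ((IsCMField.complexConj (F : Type)) • w)).unit ∈ glInt 2 (((IsCMField.complexConj (F : Type)) • w).adicCompletion (F : Type)) →
            UnitaryGroup.IsHyperspecialAt ↥(maximalRealSubfield (F : Type)) (F : Type) (IsCMField.complexConj (F : Type)) 2 Jstar K.1.1 (((IsCMField.complexConj (F : Type)) • w).under (𝓞 ↥(maximalRealSubfield (F : Type)))) →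
            ∀ 𝔓 ∈ w.primesAbove, ∀ σ : Field.absoluteGaloisGroup (F : Type), IsArithFrobAt (𝓞 (F : Type)) σ 𝔓 →
            ∀ f' ∈ (etaleHeckeDatumGS S hU7ₛ hLQ h4 isoₛ ℓ).omegaHom ι'
                ((rhoVAtLine ↥(maximalRealSubfield (F : Type)) (F : Type) (IsCMField.complexConj (F : Type)) 2
          (finProdFinEquiv : Fin 2 × Fin 1 ≃ Fin (2 * 1)) (Matrix.diagonal dJ)
          (complexConj_imagUnit F) (imagUnit_ne_zero F) (imagUnit_mul_self F) (realDiagonal_isSymm F dJ hdJ)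
          (isUnit_det_realDiagonal F dJ hdJ hdJ0) (realDiagonal_map F dJ hdJ).symm
          (hsChiGS F finProdFinEquiv dJ hdJ hdJ0
            (toHeckeCharacter (F : Type) (galConj (IsCMField.complexConj (F : Type)) μ))
            (isUnitary_toHeckeCharacter (F : Type) (galConj (IsCMField.complexConj (F : Type)) μ))
            ((isOscillatorChar_toHeckeCharacter_iff (galConj (IsCMField.complexConj (F : Type)) μ)).mpr hμ.galConj))
          (r.toFun ε) χ).comp
          (finAdelicCongr ↥(maximalRealSubfield (F : Type)) (F : Type) (IsCMField.complexConj (F : Type)) gstar ht hg).symm.toMonoidHom),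
            ∀ x ∈ Representation.fixedPoints
                ((rhoVAtLine ↥(maximalRealSubfield (F : Type)) (F : Type) (IsCMField.complexConj (F : Type)) 2
          (finProdFinEquiv : Fin 2 × Fin 1 ≃ Fin (2 * 1)) (Matrix.diagonal dJ)
          (complexConj_imagUnit F) (imagUnit_ne_zero F) (imagUnit_mul_self F) (realDiagonal_isSymm F dJ hdJ)
          (isUnit_det_realDiagonal F dJ hdJ hdJ0) (realDiagonal_map F dJ hdJ).symm
          (hsChiGS F finProdFinEquiv dJ hdJ hdJ0
            (toHeckeCharacter (F : Type) (galConj (IsCMField.complexConj (F : Type)) μ))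
            (isUnitary_toHeckeCharacter (F : Type) (galConj (IsCMField.complexConj (F : Type)) μ))
            ((isOscillatorChar_toHeckeCharacter_iff (galConj (IsCMField.complexConj (F : Type)) μ)).mpr hμ.galConj))
          (r.toFun ε) χ).comp
          (finAdelicCongr ↥(maximalRealSubfield (F : Type)) (F : Type) (IsCMField.complexConj (F : Type)) gstar ht hg).symm.toMonoidHom) K.1.1,
              (Ideal.absNorm w.asIdeal : AlgebraicClosure ℚ_[ℓ]) •
                  ((sec42DataGS S h4 isoₛ).towerRep ℓ σ).baseChange (AlgebraicClosure ℚ_[ℓ])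
                    (((sec42DataGS S h4 isoₛ).towerRep ℓ σ).baseChange (AlgebraicClosure ℚ_[ℓ])
                      (f' (UnitaryGroup.heckeTAt ↥(maximalRealSubfield (F : Type)) (F : Type) (IsCMField.complexConj (F : Type)) 2 Jstar
                        ((rhoVAtLine ↥(maximalRealSubfield (F : Type)) (F : Type) (IsCMField.complexConj (F : Type)) 2
          (finProdFinEquiv : Fin 2 × Fin 1 ≃ Fin (2 * 1)) (Matrix.diagonal dJ)
          (complexConj_imagUnit F) (imagUnit_ne_zero F) (imagUnit_mul_self F) (realDiagonal_isSymm F dJ hdJ)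
          (isUnit_det_realDiagonal F dJ hdJ hdJ0) (realDiagonal_map F dJ hdJ).symm
          (hsChiGS F finProdFinEquiv dJ hdJ hdJ0
            (toHeckeCharacter (F : Type) (galConj (IsCMField.complexConj (F : Type)) μ))
            (isUnitary_toHeckeCharacter (F : Type) (galConj (IsCMField.complexConj (F : Type)) μ))
            ((isOscillatorChar_toHeckeCharacter_iff (galConj (IsCMField.complexConj (F : Type)) μ)).mpr hμ.galConj))
          (r.toFun ε) χ).comp
          (finAdelicCongr ↥(maximalRealSubfield (F : Type)) (F : Type) (IsCMField.complexConj (F : Type)) gstar ht hg).symm.toMonoidHom)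
                        K.1.1 (⟨((IsCMField.complexConj (F : Type)) • w), rfl⟩ : UnitaryGroup.PlacesOver (F : Type) (((IsCMField.complexConj (F : Type)) • w).under (𝓞 ↥(maximalRealSubfield (F : Type)))))
                        (IsCMField.complexConj_ne_one (F : Type)) hJ hw' (UnitaryGroup.isUnit_placeForm Jstar hJu ((IsCMField.complexConj (F : Type)) • w)) (HeckeCharacter.uniformizer (F : Type) ((IsCMField.complexConj (F : Type)) • w)) 2 x))) -
                ((sec42DataGS S h4 isoₛ).towerRep ℓ σ).baseChange (AlgebraicClosure ℚ_[ℓ])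
                  (f' (UnitaryGroup.heckeTAt ↥(maximalRealSubfield (F : Type)) (F : Type) (IsCMField.complexConj (F : Type)) 2 Jstar
                    ((rhoVAtLine ↥(maximalRealSubfield (F : Type)) (F : Type) (IsCMField.complexConj (F : Type)) 2
          (finProdFinEquiv : Fin 2 × Fin 1 ≃ Fin (2 * 1)) (Matrix.diagonal dJ)
          (complexConj_imagUnit F) (imagUnit_ne_zero F) (imagUnit_mul_self F) (realDiagonal_isSymm F dJ hdJ)
          (isUnit_det_realDiagonal F dJ hdJ hdJ0) (realDiagonal_map F dJ hdJ).symm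
          (hsChiGS F finProdFinEquiv dJ hdJ hdJ0
            (toHeckeCharacter (F : Type) (galConj (IsCMField.complexConj (F : Type)) μ))
            (isUnitary_toHeckeCharacter (F : Type) (galConj (IsCMField.complexConj (F : Type)) μ))
            ((isOscillatorChar_toHeckeCharacter_iff (galConj (IsCMField.complexConj (F : Type)) μ)).mpr hμ.galConj))
          (r.toFun ε) χ).comp
          (finAdelicCongr ↥(maximalRealSubfield (F : Type)) (F : Type) (IsCMField.complexConj (F : Type)) gstar ht hg).symm.toMonoidHom)
                    K.1.1 (⟨((IsCMField.complexConj (F : Type)) • w), rfl⟩ : UnitaryGroup.PlacesOver (F : Type) (((IsCMField.complexConj (F : Type)) • w).under (𝓞 ↥(maximalRealSubfield (F : Type)))))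
                    (IsCMField.complexConj_ne_one (F : Type)) hJ hw' (UnitaryGroup.isUnit_placeForm Jstar hJu ((IsCMField.complexConj (F : Type)) • w)) (HeckeCharacter.uniformizer (F : Type) ((IsCMField.complexConj (F : Type)) • w)) 1 x)) +
                f' x = 0

/-- **THE JUNCTION `GS34` ⇐ (smoothness, S3-shape, S4-shape) for ANY representation `ω` of `U(J⋆)(𝔸_{F⁺,f})`** at the curve's
§4.2 datum: `Sph w := ⋃_{K hyperspecial at w⁺} ω^K`, `T w` / `S w` := the LOCAL spherical Hecke operators
★ `heckeT (ω ∘ inclPlace w⁺ ∘ e_w⁻¹) ϖ_w 1|2` (junk `0` at non-split places), exceptional set `S₀³ ∪ S₀⁴ ∪ {bad reduction}`; SM from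
smoothness + ★ `eventually_isHyperspecialAt` (on `K ∩ K₀`, open compact) + finiteness of the places of `F` over one place of `F⁺`;
S3/S4 from the shapes through the bridge ★ `heckeTAt_apply_eq_heckeT_apply`; good reduction a.e. by ★ `eventually_unit_placeForm_mem_glInt`. -/
theorem gs34M_of_local_shapes (F : CMField) [IsGalois ℚ F] {ι₁ : F →+* ℂ} (ℓ : ℕ) [Fact ℓ.Prime]
    (ι' : ℂ ≃+* AlgebraicClosure ℚ_[ℓ]) (Jstar : Matrix (Fin 2) (Fin 2) (F : Type))
    (K₀ : C5.OpenCompactSubgroup ↥(finAdelic ↥(maximalRealSubfield (F : Type)) (F : Type) (IsCMField.complexConj (F : Type)) 2 Jstar))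
    (S : RecordSystemGS (F : Type) Jstar ι₁ K₀) (hU7ₛ : S.HeckeTranslateDefinedOver) (hLQ : S.IsLevelQuotient)
    (h4 : 4 ≤ Module.finrank ℚ (F : Type)) (isoₛ : ℕ → Prop)
    (hJ : (Jstar.map (IsCMField.complexConj (F : Type)))ᵀ = Jstar) (hJu : IsUnit Jstar)
    {W : Type} [AddCommGroup W] [Module ℂ W] (ω : Representation ℂ ↥(finAdelic ↥(maximalRealSubfield (F : Type)) (F : Type) (IsCMField.complexConj (F : Type)) 2 Jstar) W) (μ₁ μ₂ : HeckeCharacter (F : Type))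
    (hSM : ∀ x : W, ∃ K : Subgroup ↥(finAdelic ↥(maximalRealSubfield (F : Type)) (F : Type) (IsCMField.complexConj (F : Type)) 2 Jstar), IsOpen (K : Set ↥(finAdelic ↥(maximalRealSubfield (F : Type)) (F : Type) (IsCMField.complexConj (F : Type)) 2 Jstar)) ∧ ∀ g ∈ K, ω g x = x)
    (h3 : ∀ K : C5.SmallLevel K₀, ∃ S₀ : Set (HeightOneSpectrum (𝓞 (F : Type))), S₀.Finite ∧
      ∀ w : HeightOneSpectrum (𝓞 (F : Type)), w ∉ S₀ → ∀ hw : (IsCMField.complexConj (F : Type)) • w ≠ w,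
        ∀ hw' : (IsCMField.complexConj (F : Type)) • ((IsCMField.complexConj (F : Type)) • w) ≠ ((IsCMField.complexConj (F : Type)) • w),
        (UnitaryGroup.isUnit_placeForm Jstar hJu ((IsCMField.complexConj (F : Type)) • w)).unit ∈ glInt 2 (((IsCMField.complexConj (F : Type)) • w).adicCompletion (F : Type)) →
            UnitaryGroup.IsHyperspecialAt ↥(maximalRealSubfield (F : Type)) (F : Type) (IsCMField.complexConj (F : Type)) 2 Jstar K.1.1 (((IsCMField.complexConj (F : Type)) • w).under (𝓞 ↥(maximalRealSubfield (F : Type)))) →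
            ∀ 𝔓 ∈ w.primesAbove, ∀ σ : Field.absoluteGaloisGroup (F : Type), IsArithFrobAt (𝓞 (F : Type)) σ 𝔓 →
            ∀ f' ∈ (etaleHeckeDatumGS S hU7ₛ hLQ h4 isoₛ ℓ).omegaHom ι' ω, ∀ x ∈ Representation.fixedPoints ω K.1.1,
              (Ideal.absNorm w.asIdeal : AlgebraicClosure ℚ_[ℓ]) •
                  ((sec42DataGS S h4 isoₛ).towerRep ℓ σ).baseChange (AlgebraicClosure ℚ_[ℓ])
                    (((sec42DataGS S h4 isoₛ).towerRep ℓ σ).baseChange (AlgebraicClosure ℚ_[ℓ])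
                      (f' (UnitaryGroup.heckeTAt ↥(maximalRealSubfield (F : Type)) (F : Type) (IsCMField.complexConj (F : Type)) 2 Jstar ω K.1.1 (⟨((IsCMField.complexConj (F : Type)) • w), rfl⟩ : UnitaryGroup.PlacesOver (F : Type) (((IsCMField.complexConj (F : Type)) • w).under (𝓞 ↥(maximalRealSubfield (F : Type)))))
                  (IsCMField.complexConj_ne_one (F : Type)) hJ hw' (UnitaryGroup.isUnit_placeForm Jstar hJu ((IsCMField.complexConj (F : Type)) • w)) (HeckeCharacter.uniformizer (F : Type) ((IsCMField.complexConj (F : Type)) • w)) 2 x))) -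
                ((sec42DataGS S h4 isoₛ).towerRep ℓ σ).baseChange (AlgebraicClosure ℚ_[ℓ])
                  (f' (UnitaryGroup.heckeTAt ↥(maximalRealSubfield (F : Type)) (F : Type) (IsCMField.complexConj (F : Type)) 2 Jstar ω K.1.1 (⟨((IsCMField.complexConj (F : Type)) • w), rfl⟩ : UnitaryGroup.PlacesOver (F : Type) (((IsCMField.complexConj (F : Type)) • w).under (𝓞 ↥(maximalRealSubfield (F : Type)))))
                  (IsCMField.complexConj_ne_one (F : Type)) hJ hw' (UnitaryGroup.isUnit_placeForm Jstar hJu ((IsCMField.complexConj (F : Type)) • w)) (HeckeCharacter.uniformizer (F : Type) ((IsCMField.complexConj (F : Type)) • w)) 1 x)) +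
                f' x = 0)
    (h4s : ∃ S₀ : Set (HeightOneSpectrum (𝓞 (F : Type))), S₀.Finite ∧
      ∀ w : HeightOneSpectrum (𝓞 (F : Type)), w ∉ S₀ → ∀ hw : (IsCMField.complexConj (F : Type)) • w ≠ w,
        (UnitaryGroup.isUnit_placeForm Jstar hJu w).unit ∈ glInt 2 (w.adicCompletion (F : Type)) →
          ∀ K : Subgroup ↥(finAdelic ↥(maximalRealSubfield (F : Type)) (F : Type) (IsCMField.complexConj (F : Type)) 2 Jstar),
            UnitaryGroup.IsHyperspecialAt ↥(maximalRealSubfield (F : Type)) (F : Type) (IsCMField.complexConj (F : Type)) 2 Jstar K (w.under (𝓞 ↥(maximalRealSubfield (F : Type)))) →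
            ∀ x ∈ Representation.fixedPoints ω K,
              UnitaryGroup.heckeTAt ↥(maximalRealSubfield (F : Type)) (F : Type) (IsCMField.complexConj (F : Type)) 2 Jstar ω K (⟨w, rfl⟩ : UnitaryGroup.PlacesOver (F : Type) (w.under (𝓞 ↥(maximalRealSubfield (F : Type)))))
                  (IsCMField.complexConj_ne_one (F : Type)) hJ hw (UnitaryGroup.isUnit_placeForm Jstar hJu w) (HeckeCharacter.uniformizer (F : Type) w) 1 x =
                (μ₁.valueAtUniformizer w + μ₂.valueAtUniformizer w) • x ∧
              (Ideal.absNorm w.asIdeal : ℂ) •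
                UnitaryGroup.heckeTAt ↥(maximalRealSubfield (F : Type)) (F : Type) (IsCMField.complexConj (F : Type)) 2 Jstar ω K (⟨w, rfl⟩ : UnitaryGroup.PlacesOver (F : Type) (w.under (𝓞 ↥(maximalRealSubfield (F : Type)))))
                  (IsCMField.complexConj_ne_one (F : Type)) hJ hw (UnitaryGroup.isUnit_placeForm Jstar hJu w) (HeckeCharacter.uniformizer (F : Type) w) 2 x =
                (μ₁.valueAtUniformizer w * μ₂.valueAtUniformizer w) • x) :
    GS34 (sec42DataGS S h4 isoₛ) ℓ (etaleHeckeDatumGS S hU7ₛ hLQ h4 isoₛ ℓ) ι' ω (IsCMField.complexConj (F : Type))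
      (HeckeCharacter.galConj (IsCMField.complexConj (F : Type)) μ₁) (HeckeCharacter.galConj (IsCMField.complexConj (F : Type)) μ₂) := by
  classical
  -- `c • (c • w) = w`, so `c • w` is split too, and `w ↦ c • w` is injective (finite exceptional sets pull back)
  have hcc : ∀ w : HeightOneSpectrum (𝓞 (F : Type)), (IsCMField.complexConj (F : Type)) • ((IsCMField.complexConj (F : Type)) • w) = w :=
    fun w => by rw [smul_smul, Literature.NumberTheory.Automorphic.Liu2021.Def411WeilCarriers.complexConj_mul_complexConj', one_smul]
  have hsw : ∀ {w : HeightOneSpectrum (𝓞 (F : Type))}, (IsCMField.complexConj (F : Type)) • w ≠ w →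
      (IsCMField.complexConj (F : Type)) • ((IsCMField.complexConj (F : Type)) • w) ≠ (IsCMField.complexConj (F : Type)) • w :=
    fun {w} hw h => hw ((hcc w).symm.trans h).symm
  have hinj : Function.Injective (fun w : HeightOneSpectrum (𝓞 (F : Type)) => (IsCMField.complexConj (F : Type)) • w) :=
    MulAction.injective _
  choose S₃ hS₃ h3' using h3
  obtain ⟨S₄, hS₄, h4'⟩ := h4s
  -- good reduction of `J⋆` at almost every place (★ `eventually_unit_placeForm_mem_glInt`)
  have hGood : {w : HeightOneSpectrum (𝓞 (F : Type)) |
      ¬ ((UnitaryGroup.isUnit_placeForm Jstar hJu w).unit ∈ glInt 2 (w.adicCompletion (F : Type)))}.Finite :=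
    Filter.eventually_cofinite.mp (UnitaryGroup.eventually_unit_placeForm_mem_glInt (N := 2) Jstar hJu)
  -- … pulled back along `w ↦ c • w`, together with `S₄` and the ramification of the two labels
  have hGood' : ((fun w : HeightOneSpectrum (𝓞 (F : Type)) => (IsCMField.complexConj (F : Type)) • w) ⁻¹'
      {w : HeightOneSpectrum (𝓞 (F : Type)) |
        ¬ ((UnitaryGroup.isUnit_placeForm Jstar hJu w).unit ∈ glInt 2 (w.adicCompletion (F : Type)))}).Finite :=
    Set.Finite.preimage hinj.injOn hGood
  have hS₄' : ((fun w : HeightOneSpectrum (𝓞 (F : Type)) => (IsCMField.complexConj (F : Type)) • w) ⁻¹' S₄).Finite :=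
    Set.Finite.preimage hinj.injOn hS₄
  have hR₁ : ((fun w : HeightOneSpectrum (𝓞 (F : Type)) => (IsCMField.complexConj (F : Type)) • w) ⁻¹' μ₁.ramifiedPlaces).Finite :=
    Set.Finite.preimage hinj.injOn (HeckeCharacter.finite_ramifiedPlaces_holds μ₁)
  have hR₂ : ((fun w : HeightOneSpectrum (𝓞 (F : Type)) => (IsCMField.complexConj (F : Type)) • w) ⁻¹' μ₂.ramifiedPlaces).Finite :=
    Set.Finite.preimage hinj.injOn (HeckeCharacter.finite_ramifiedPlaces_holds μ₂)
  -- the spherical predicates: `K`-fixed for SOME level `K` hyperspecial at `w⁺`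
  let Sph : HeightOneSpectrum (𝓞 (F : Type)) → Set W := fun w =>
    {x | ∃ K : C5.SmallLevel K₀,
      UnitaryGroup.IsHyperspecialAt ↥(maximalRealSubfield (F : Type)) (F : Type) (IsCMField.complexConj (F : Type)) 2 Jstar K.1.1 (w.under (𝓞 ↥(maximalRealSubfield (F : Type)))) ∧
        x ∈ Representation.fixedPoints ω K.1.1 ∧ w ∉ S₃ K}
  -- the LOCAL spherical Hecke operators at a split place (junk `0` at the non-split places)
  let Tloc : HeightOneSpectrum (𝓞 (F : Type)) → ℕ → (W →ₗ[ℂ] W) := fun w i =>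
    if hw : (IsCMField.complexConj (F : Type)) • w ≠ w then
      heckeT (ω.comp ((UnitaryGroup.inclPlace ↥(maximalRealSubfield (F : Type)) (F : Type) (IsCMField.complexConj (F : Type)) 2 Jstar (((IsCMField.complexConj (F : Type)) • w).under (𝓞 ↥(maximalRealSubfield (F : Type))))).comp
        (localPiSplitEquiv (IsCMField.complexConj (F : Type)) Jstar (IsCMField.complexConj_ne_one (F : Type)) hJ (⟨((IsCMField.complexConj (F : Type)) • w), rfl⟩ : UnitaryGroup.PlacesOver (F : Type) (((IsCMField.complexConj (F : Type)) • w).under (𝓞 ↥(maximalRealSubfield (F : Type))))) (hsw hw) (UnitaryGroup.isUnit_placeForm Jstar hJu ((IsCMField.complexConj (F : Type)) • w))).symm.toMonoidHom)) (HeckeCharacter.uniformizer (F : Type) ((IsCMField.complexConj (F : Type)) • w)) i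
    else 0
  have hTloc : ∀ (w : HeightOneSpectrum (𝓞 (F : Type))) (hw : (IsCMField.complexConj (F : Type)) • w ≠ w) (i : ℕ) (x : W),
      Tloc w i x = heckeT (ω.comp ((UnitaryGroup.inclPlace ↥(maximalRealSubfield (F : Type)) (F : Type) (IsCMField.complexConj (F : Type)) 2 Jstar (((IsCMField.complexConj (F : Type)) • w).under (𝓞 ↥(maximalRealSubfield (F : Type))))).comp
        (localPiSplitEquiv (IsCMField.complexConj (F : Type)) Jstar (IsCMField.complexConj_ne_one (F : Type)) hJ (⟨((IsCMField.complexConj (F : Type)) • w), rfl⟩ : UnitaryGroup.PlacesOver (F : Type) (((IsCMField.complexConj (F : Type)) • w).under (𝓞 ↥(maximalRealSubfield (F : Type))))) (hsw hw) (UnitaryGroup.isUnit_placeForm Jstar hJu ((IsCMField.complexConj (F : Type)) • w))).symm.toMonoidHom)) (HeckeCharacter.uniformizer (F : Type) ((IsCMField.complexConj (F : Type)) • w)) i x := by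
    intro w hw i x
    simp only [Tloc, dif_pos hw]
  refine ⟨Sph, fun w => Tloc w 1, fun w => Tloc w 2,
    (((fun w : HeightOneSpectrum (𝓞 (F : Type)) => (IsCMField.complexConj (F : Type)) • w) ⁻¹' S₄) ∪
      ((fun w : HeightOneSpectrum (𝓞 (F : Type)) => (IsCMField.complexConj (F : Type)) • w) ⁻¹'
        {w : HeightOneSpectrum (𝓞 (F : Type)) |
          ¬ ((UnitaryGroup.isUnit_placeForm Jstar hJu w).unit ∈ glInt 2 (w.adicCompletion (F : Type)))})) ∪
    (((fun w : HeightOneSpectrum (𝓞 (F : Type)) => (IsCMField.complexConj (F : Type)) • w) ⁻¹' μ₁.ramifiedPlaces) ∪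
      ((fun w : HeightOneSpectrum (𝓞 (F : Type)) => (IsCMField.complexConj (F : Type)) • w) ⁻¹' μ₂.ramifiedPlaces)),
    (hS₄'.union hGood').union (hR₁.union hR₂), fun x => ?_, ?_, ?_⟩
  · -- SM: every vector is spherical at almost every place
    obtain ⟨K, hKo, hKfix⟩ := hSM x
    have hKcl : IsClosed (K : Set ↥(finAdelic ↥(maximalRealSubfield (F : Type)) (F : Type) (IsCMField.complexConj (F : Type)) 2 Jstar)) := K.isClosed_of_isOpen hKo
    have hK'o : IsOpen ((K ⊓ K₀.1 : Subgroup ↥(finAdelic ↥(maximalRealSubfield (F : Type)) (F : Type) (IsCMField.complexConj (F : Type)) 2 Jstar)) : Set ↥(finAdelic ↥(maximalRealSubfield (F : Type)) (F : Type) (IsCMField.complexConj (F : Type)) 2 Jstar)) := by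
      rw [Subgroup.coe_inf]; exact hKo.inter K₀.2.1
    have hK'c : IsCompact ((K ⊓ K₀.1 : Subgroup ↥(finAdelic ↥(maximalRealSubfield (F : Type)) (F : Type) (IsCMField.complexConj (F : Type)) 2 Jstar)) : Set ↥(finAdelic ↥(maximalRealSubfield (F : Type)) (F : Type) (IsCMField.complexConj (F : Type)) 2 Jstar)) := by
      rw [Subgroup.coe_inf]; exact K₀.2.2.inter_left hKcl
    let K' : C5.SmallLevel K₀ := ⟨⟨K ⊓ K₀.1, hK'o, hK'c⟩, fun g hg => (Subgroup.mem_inf.1 hg).2⟩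
    have hev := UnitaryGroup.eventually_isHyperspecialAt ↥(maximalRealSubfield (F : Type)) (F : Type) (IsCMField.complexConj (F : Type)) 2 Jstar (K ⊓ K₀.1) hK'o hK'c
    have hev' : ∀ᶠ w : HeightOneSpectrum (𝓞 (F : Type)) in cofinite,
        UnitaryGroup.IsHyperspecialAt ↥(maximalRealSubfield (F : Type)) (F : Type) (IsCMField.complexConj (F : Type)) 2 Jstar (K ⊓ K₀.1) (w.under (𝓞 ↥(maximalRealSubfield (F : Type)))) := by
      rw [Filter.eventually_cofinite] at hev ⊢
      refine (hev.preimage' fun v _ => ?_).subset fun w hw => hw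
      exact (Set.finite_range (fun w' : UnitaryGroup.PlacesOver (F : Type) v => w'.1)).subset
        fun w hw => ⟨⟨w, hw⟩, rfl⟩
    have hS3' : ∀ᶠ w : HeightOneSpectrum (𝓞 (F : Type)) in cofinite, w ∉ S₃ K' := (hS₃ K').compl_mem_cofinite
    filter_upwards [hev', hS3'] with w hw hw3
    exact ⟨K', hw, (ω.mem_fixedPoints _ x).2 fun g hg => hKfix g (Subgroup.mem_inf.1 hg).1, hw3⟩
  · -- S3 from the S3-shape through the bridge
    intro w hwS hw 𝔓 h𝔓 σ hσ f' hf' x hx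
    obtain ⟨K, hK, hxK, hw3⟩ := hx
    simp only [Set.mem_union, Set.mem_preimage, not_or, Set.mem_setOf_eq, not_not] at hwS
    obtain ⟨⟨-, hJi⟩, -, -⟩ := hwS
    have hw' := hsw hw
    have hK' : UnitaryGroup.IsHyperspecialAt ↥(maximalRealSubfield (F : Type)) (F : Type) (IsCMField.complexConj (F : Type)) 2 Jstar K.1.1
        (((IsCMField.complexConj (F : Type)) • w).under (𝓞 ↥(maximalRealSubfield (F : Type)))) := by
      rw [HeightOneSpectrum.under_smul]; exact hK
    have rel := h3' K w hw3 hw hw' hJi hK' 𝔓 h𝔓 σ hσ f' hf' x hxK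
    have e1 : Tloc w 1 x = UnitaryGroup.heckeTAt ↥(maximalRealSubfield (F : Type)) (F : Type) (IsCMField.complexConj (F : Type)) 2 Jstar ω K.1.1 (⟨((IsCMField.complexConj (F : Type)) • w), rfl⟩ : UnitaryGroup.PlacesOver (F : Type) (((IsCMField.complexConj (F : Type)) • w).under (𝓞 ↥(maximalRealSubfield (F : Type)))))
                  (IsCMField.complexConj_ne_one (F : Type)) hJ hw' (UnitaryGroup.isUnit_placeForm Jstar hJu ((IsCMField.complexConj (F : Type)) • w)) (HeckeCharacter.uniformizer (F : Type) ((IsCMField.complexConj (F : Type)) • w)) 1 x :=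
      (hTloc w hw 1 x).trans (UnitaryGroup.heckeTAt_apply_eq_heckeT_apply ω hK' (⟨((IsCMField.complexConj (F : Type)) • w), rfl⟩ : UnitaryGroup.PlacesOver (F : Type) (((IsCMField.complexConj (F : Type)) • w).under (𝓞 ↥(maximalRealSubfield (F : Type)))))
        (IsCMField.complexConj_ne_one (F : Type)) hJ hw' (UnitaryGroup.isUnit_placeForm Jstar hJu ((IsCMField.complexConj (F : Type)) • w)) hJi (HeckeCharacter.uniformizer (F : Type) ((IsCMField.complexConj (F : Type)) • w)) 1 hxK).symm
    have e2 : Tloc w 2 x = UnitaryGroup.heckeTAt ↥(maximalRealSubfield (F : Type)) (F : Type) (IsCMField.complexConj (F : Type)) 2 Jstar ω K.1.1 (⟨((IsCMField.complexConj (F : Type)) • w), rfl⟩ : UnitaryGroup.PlacesOver (F : Type) (((IsCMField.complexConj (F : Type)) • w).under (𝓞 ↥(maximalRealSubfield (F : Type)))))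
                  (IsCMField.complexConj_ne_one (F : Type)) hJ hw' (UnitaryGroup.isUnit_placeForm Jstar hJu ((IsCMField.complexConj (F : Type)) • w)) (HeckeCharacter.uniformizer (F : Type) ((IsCMField.complexConj (F : Type)) • w)) 2 x :=
      (hTloc w hw 2 x).trans (UnitaryGroup.heckeTAt_apply_eq_heckeT_apply ω hK' (⟨((IsCMField.complexConj (F : Type)) • w), rfl⟩ : UnitaryGroup.PlacesOver (F : Type) (((IsCMField.complexConj (F : Type)) • w).under (𝓞 ↥(maximalRealSubfield (F : Type)))))
        (IsCMField.complexConj_ne_one (F : Type)) hJ hw' (UnitaryGroup.isUnit_placeForm Jstar hJu ((IsCMField.complexConj (F : Type)) • w)) hJi (HeckeCharacter.uniformizer (F : Type) ((IsCMField.complexConj (F : Type)) • w)) 2 hxK).symm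
    have key : ∀ y₂ y₁ : W,
        y₂ = UnitaryGroup.heckeTAt ↥(maximalRealSubfield (F : Type)) (F : Type) (IsCMField.complexConj (F : Type)) 2 Jstar ω K.1.1 (⟨((IsCMField.complexConj (F : Type)) • w), rfl⟩ : UnitaryGroup.PlacesOver (F : Type) (((IsCMField.complexConj (F : Type)) • w).under (𝓞 ↥(maximalRealSubfield (F : Type)))))
                  (IsCMField.complexConj_ne_one (F : Type)) hJ hw' (UnitaryGroup.isUnit_placeForm Jstar hJu ((IsCMField.complexConj (F : Type)) • w)) (HeckeCharacter.uniformizer (F : Type) ((IsCMField.complexConj (F : Type)) • w)) 2 x →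
        y₁ = UnitaryGroup.heckeTAt ↥(maximalRealSubfield (F : Type)) (F : Type) (IsCMField.complexConj (F : Type)) 2 Jstar ω K.1.1 (⟨((IsCMField.complexConj (F : Type)) • w), rfl⟩ : UnitaryGroup.PlacesOver (F : Type) (((IsCMField.complexConj (F : Type)) • w).under (𝓞 ↥(maximalRealSubfield (F : Type)))))
                  (IsCMField.complexConj_ne_one (F : Type)) hJ hw' (UnitaryGroup.isUnit_placeForm Jstar hJu ((IsCMField.complexConj (F : Type)) • w)) (HeckeCharacter.uniformizer (F : Type) ((IsCMField.complexConj (F : Type)) • w)) 1 x →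
        (Ideal.absNorm w.asIdeal : AlgebraicClosure ℚ_[ℓ]) •
            ((sec42DataGS S h4 isoₛ).towerRep ℓ σ).baseChange (AlgebraicClosure ℚ_[ℓ])
              (((sec42DataGS S h4 isoₛ).towerRep ℓ σ).baseChange (AlgebraicClosure ℚ_[ℓ]) (f' y₂)) -
          ((sec42DataGS S h4 isoₛ).towerRep ℓ σ).baseChange (AlgebraicClosure ℚ_[ℓ]) (f' y₁) + f' x = 0 := by
      rintro _ _ rfl rfl
      exact rel
    exact key _ _ e2 e1
  · -- S4 from the S4-shape through the bridge
    intro w hwS hw x hx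
    obtain ⟨K, hK, hxK, -⟩ := hx
    simp only [Set.mem_union, Set.mem_preimage, not_or, Set.mem_setOf_eq, not_not, HeckeCharacter.ramifiedPlaces] at hwS
    obtain ⟨⟨hw4, hJi⟩, hur₁, hur₂⟩ := hwS
    have hw' := hsw hw
    have hK' : UnitaryGroup.IsHyperspecialAt ↥(maximalRealSubfield (F : Type)) (F : Type) (IsCMField.complexConj (F : Type)) 2 Jstar K.1.1
        (((IsCMField.complexConj (F : Type)) • w).under (𝓞 ↥(maximalRealSubfield (F : Type)))) := by
      rw [HeightOneSpectrum.under_smul]; exact hK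
    -- S4 read at the CONJUGATE place `c • w`
    obtain ⟨hT, hS⟩ := h4' ((IsCMField.complexConj (F : Type)) • w) hw4 hw' hJi K.1.1 hK' x hxK
    have e1 : Tloc w 1 x = UnitaryGroup.heckeTAt ↥(maximalRealSubfield (F : Type)) (F : Type) (IsCMField.complexConj (F : Type)) 2 Jstar ω K.1.1 (⟨((IsCMField.complexConj (F : Type)) • w), rfl⟩ : UnitaryGroup.PlacesOver (F : Type) (((IsCMField.complexConj (F : Type)) • w).under (𝓞 ↥(maximalRealSubfield (F : Type)))))
                  (IsCMField.complexConj_ne_one (F : Type)) hJ hw' (UnitaryGroup.isUnit_placeForm Jstar hJu ((IsCMField.complexConj (F : Type)) • w)) (HeckeCharacter.uniformizer (F : Type) ((IsCMField.complexConj (F : Type)) • w)) 1 x :=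
      (hTloc w hw 1 x).trans (UnitaryGroup.heckeTAt_apply_eq_heckeT_apply ω hK' (⟨((IsCMField.complexConj (F : Type)) • w), rfl⟩ : UnitaryGroup.PlacesOver (F : Type) (((IsCMField.complexConj (F : Type)) • w).under (𝓞 ↥(maximalRealSubfield (F : Type)))))
        (IsCMField.complexConj_ne_one (F : Type)) hJ hw' (UnitaryGroup.isUnit_placeForm Jstar hJu ((IsCMField.complexConj (F : Type)) • w)) hJi (HeckeCharacter.uniformizer (F : Type) ((IsCMField.complexConj (F : Type)) • w)) 1 hxK).symm
    have e2 : Tloc w 2 x = UnitaryGroup.heckeTAt ↥(maximalRealSubfield (F : Type)) (F : Type) (IsCMField.complexConj (F : Type)) 2 Jstar ω K.1.1 (⟨((IsCMField.complexConj (F : Type)) • w), rfl⟩ : UnitaryGroup.PlacesOver (F : Type) (((IsCMField.complexConj (F : Type)) • w).under (𝓞 ↥(maximalRealSubfield (F : Type)))))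
                  (IsCMField.complexConj_ne_one (F : Type)) hJ hw' (UnitaryGroup.isUnit_placeForm Jstar hJu ((IsCMField.complexConj (F : Type)) • w)) (HeckeCharacter.uniformizer (F : Type) ((IsCMField.complexConj (F : Type)) • w)) 2 x :=
      (hTloc w hw 2 x).trans (UnitaryGroup.heckeTAt_apply_eq_heckeT_apply ω hK' (⟨((IsCMField.complexConj (F : Type)) • w), rfl⟩ : UnitaryGroup.PlacesOver (F : Type) (((IsCMField.complexConj (F : Type)) • w).under (𝓞 ↥(maximalRealSubfield (F : Type)))))
        (IsCMField.complexConj_ne_one (F : Type)) hJ hw' (UnitaryGroup.isUnit_placeForm Jstar hJu ((IsCMField.complexConj (F : Type)) • w)) hJi (HeckeCharacter.uniformizer (F : Type) ((IsCMField.complexConj (F : Type)) • w)) 2 hxK).symm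
    -- labels: `(galConj c μ_i).valueAtUniformizer w = μ_i.valueAtUniformizer (c • w)` off `ram(μ_i)` (★), `N(c • w) = N(w)` (★)
    refine ⟨?_, ?_⟩
    · change Tloc w 1 x = _
      rw [e1, HeckeCharacter.valueAtUniformizer_galConj_of_isUnramifiedAt _ μ₁ w hur₁,
        HeckeCharacter.valueAtUniformizer_galConj_of_isUnramifiedAt _ μ₂ w hur₂]
      exact hT
    · change (Ideal.absNorm w.asIdeal : ℂ) • Tloc w 2 x = _
      rw [e2, HeckeCharacter.valueAtUniformizer_galConj_of_isUnramifiedAt _ μ₁ w hur₁,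
        HeckeCharacter.valueAtUniformizer_galConj_of_isUnramifiedAt _ μ₂ w hur₂,
        ← HeightOneSpectrum.absNorm_algEquiv_smul (σ := IsCMField.complexConj (F : Type)) (w := w)]
      exact hS

/-- **`SocketS34M` from the four shapes** — the instantiation line the S3/S4 FACT typers copy: per label,
`gs34M_of_local_shapes` at `ω := ω⋆_lab` with the chain labels `((μ^{alg})ᶜ, μ^{alg}χ̌)`, conjugated once by the `c • w` reading. -/
theorem socketS34M_of_shapes (hJs : JstarShape) (hSM : SMShape) (h3 : S3ShapeM) (h4 : S4ShapeA) : SocketS34M := by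
  intro F _ ι₁ μ hμ hw ℓ _ ι' Jstar t ht hτt hτt' gstar dJ hdJ hdJ0 hg hsig K₀ S hU7ₛ hLQ h4' isoₛ r ε hadm χ
  obtain ⟨hJ, hJu⟩ := hJs F ι₁ μ hμ hw ℓ ι' Jstar t ht hτt hτt' gstar dJ hdJ hdJ0 hg hsig K₀ S hU7ₛ hLQ h4' isoₛ r ε hadm χ
  have key := gs34M_of_local_shapes F ℓ ι' Jstar K₀ S hU7ₛ hLQ h4' isoₛ hJ hJu _
    (HeckeCharacter.galConj (IsCMField.complexConj (F : Type)) (IdeleClassGroup.muAlg (F : Type) μ))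
    (IdeleClassGroup.muAlg (F : Type) μ * HeckeCharacter.checkOfChi (Literature.NumberTheory.Automorphic.Liu2021.Def411WeilCarriers.complexConj_mul_complexConj' (F : Type)) χ)
    (hSM F ι₁ μ hμ hw ℓ ι' Jstar t ht hτt hτt' gstar dJ hdJ hdJ0 hg hsig K₀ S hU7ₛ hLQ h4' isoₛ r ε hadm χ)
    (h3 F ι₁ μ hμ hw ℓ ι' Jstar t ht hτt hτt' gstar dJ hdJ hdJ0 hg hsig K₀ S hU7ₛ hLQ h4' isoₛ r ε hadm χ hJ hJu)
    (h4 F ι₁ μ hμ hw ℓ ι' Jstar t ht hτt hτt' gstar dJ hdJ hdJ0 hg hsig K₀ S hU7ₛ hLQ h4' isoₛ r ε hadm χ hJ hJu)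
  -- `(galConj c ((μ^{alg})ᶜ), galConj c (μ^{alg}·χ̌)) = (μ^{alg}, (μ^{alg})ᶜ·χ̌ᶜ)`: `c² = 1`, ★ `galConj_mul`
  have e2 : HeckeCharacter.galConj (IsCMField.complexConj (F : Type))
      (HeckeCharacter.galConj (IsCMField.complexConj (F : Type)) (IdeleClassGroup.muAlg (F : Type) μ)) =
        IdeleClassGroup.muAlg (F : Type) μ := by
    rw [HeckeCharacter.galConj_galConj, Literature.NumberTheory.Automorphic.Liu2021.Def411WeilCarriers.complexConj_mul_complexConj', HeckeCharacter.galConj_one]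
  rw [e2, HeckeCharacter.galConj_mul] at key
  exact key

/-- **THE HEAD, D2/D3 EDITION (WORLD M)**: the REGISTERED `thmD6OneCurveCUF` from S1′, S2, the two FACT shapes S3/S4 by name, smoothness and
`ᵗ(cJ⋆) = J⋆ ∈ GL₂(F)`. -/
theorem thmD6OneCurveCUF_M_of_shapes (h1 : SocketS1) (h2 : SocketS2) (hJs : JstarShape) (hSM : SMShape)
    (h3 : S3ShapeM) (h4 : S4ShapeA) : thmD6OneCurveCUF :=
  thmD6OneCurveCUF_M_of_sockets h1 h2 (socketS34M_of_shapes hJs hSM h3 h4)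

end Summit.HodgeConjecture.CorCM.Lines.A3Liu418
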